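import Summits.QuantumFields.BalabanUV.Beta.D1BFx.RProjectorJetLeibniz

/-!
# `BalabanUV.Beta.D1BFx.RProjectorJetColumns` — road «BF-x» for binder row D1, leaf J5 (KERNEL LEVEL, part 3): THE SECOND RECOGNITION
# IDENTITY ON `ℤ⁴` — `Ṙ_s∘X + R∘Ẋ_s = 0` for the typed site jet `Rdot`, the typed column family `X = G′Q′*` (`Xk`, columns `gq`) and its
# stripped variation `Ẋ_s = −G′∘V∘X + G′∘(Q̇′ᴴ)_s` (`V = Sgh`, `(Q̇′ᴴ)_s = Qadj`); with part 2 this is the full socket `eq_cojetSkew_iff`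
# of `D1BFx/ProjectorJetStripped`, checked on the lattice

HONEST DEPENDENCY (page 1, mandatory): continuum YM on T⁴ ⇐ BetaPertH ∧ nine spine estimates (0/9 proved); BetaPertH ⇐ (D1) ∧ (D4) ∧
CAP+tail; G-an2-4 gates asym, D1 and NE2/3/4.  HONEST FRAMING: discharging `BetaPertH` makes Bałaban's UV stability UNCONDITIONAL — NOT
the continuum limit and NOT the Clay problem.  THIS FILE DISCHARGES NOTHING of the wall: [folklore] algebra of absolutely convergent
lattice-kernel compositions + ONE Fubini exchange (`B5Hk103ScalarZd.tsum_mul_tsum_comm`), over leaf-09's `RProjector(Range)` and the typer's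
T6 BY NAME; 0 binders of row D1 touched; no `def … : Prop`, no cited hypothesis.  Two data definitions (`Xk`, `Qadj`) assert nothing.

CONTENT.
* §1 [our objects] `Xk n a p y := gq (n−1) a p y` — the column family `X = G′Q′*` (fine site `p`, block label `y`) as a `Unit`-fibred kernel;
  `Qadj n κ′ u s y := −n⁴·qJet n κ′ u y s` — the STRIPPED ADJOINT averaging jet `(Q̇′ᴴ)_s` (T6's `qAnti` convention, cf. `RProjectorJet` §3).
  [folklore] `tame_Xk`, `loc_Qadj`, **`comp_Pgt_Xk : comp (Pgt n a) (Xk n a) = Xk n a`** (`P∘X = X`, = `RProjectorRange.tsum_gq_mul_Pgt` +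
  symmetry), the lattice identity **`tsum_kerP_mul_gq`** (`Σ'_r kerP m a r y · gq m a r y′ = (m+1)^d·[y = y′]`, i.e. `X⁺∘X = 1`; one Fubini,
  `tsum_bb_eq_kerSq` + `tsum_kerSq_mul_Csq` BY NAME) and **`comp_Jq_Xk : comp (Jq n a κ′ u) (Xk n a) = Qadj n κ′ u`** (`J∘X = (Q̇′ᴴ)_s`).
* §2 [folklore] GENERIC: for `Spr G`, `Spr P`, `Loc V`, `Loc J`, `Tame X`, `Tame Q` with `P∘P = P`, `Pᵀ = P`, `Gᵀ = G`, `Vᵀ = −V`, `P∘X = X`,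
  `J∘X = Q`: `comp_RG_sub_X` (`(G − G∘P)∘X = 0`), the four corner identities against `X`, and
  **`leibniz_X`**: `comp (rdotOf G P V J) X + (comp (idK − P) (comp G Q) − comp (idK − P) (comp (comp G V) X)) = 0`.
* §3 [folklore] THE INSTANCE: **`leibniz_X_Rdot`**: for `Rdot n a cK cQ κ′ u`, `X := Xk n a`, `Q := Qadj n κ′ u`, `G := Ggh n a`,
  `P := Pgt n a`, `V := Sgh n cK cQ κ′ u`, GIVEN `hP : Decays (Pgt n a) CP δP`, `0 < δP` (leaf-05-g3's `decays_Pgt`; bookkeeping only).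
Unit `b2b-balaban-beta-d1-formalise-leaf-07` (gen 2).
-/

namespace Summit.QuantumFields.BalabanUV.Beta.D1BFx.RProjectorJetColumns

open Literature.MathematicalPhysics.QuantumFieldTheory.Balaban1983to89
open Literature.MathematicalPhysics.QuantumFieldTheory.Balaban1983to89.Beta
open B12Sec2to5 (l1 l1_nonneg)
open B4Sect5Proof (latticeConst latticeConst_nonneg)
open B6QGQLower276 (X B blk mem_B)
open B6QGQDecay237 (cU deltaU cU_pos deltaU_pos)
open B5Hk103ScalarZd (gq abs_gq_le tsum_mul_tsum_comm tsum_blocks summable_expX)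
open B6QGGQ278Zd (kerSq Csq cC cC_pos deltaC deltaC_pos abs_Csq_le abs_blockSum_le)
open ExpKernelCalculus (Site MKer Decays BiLoc comp)
open HessKerSchurResolvent (idK comp_idK_left comp_idK_right)
open KernelWard (Bdd bdd_of_decays bdd_of_biLoc)
open Summit.QuantumFields.BalabanUV.Beta.TameKernelCalculus (trK trK_apply trK_trK trK_sub trK_neg trK_comp Spr Loc Tame Spr.tame Loc.tame
  Spr.comp_loc Loc.comp_spr Loc.trK Loc.sub Loc.neg spr_idK comp_assoc_tame comp_sub_left_tame comp_sub_right_tame comp_neg_left comp_neg_right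
  decays_of_le)
open GhostLeg (Ggh spr_Ggh cast_pred_add_one)
open GhostStencil (qJet Sgh Sgh_antisymm qJet_eq_zero abs_qJet_le l1_sub_le_of_blk_eq)
open RProjector (kerP Pker Pgt Pgt_apply Pgt_symm cP deltaP cP_nonneg deltaP_pos cPP deltaPP cPP_nonneg deltaPP_pos abs_kerP_le abs_gq_le_const
  sum_mul_kerP tsum_kerSq_mul_Csq)
open RProjectorRange (tsum_gq_mul_Pgt tsum_bb_eq_kerSq summable_of_blk_majorant summable_gq_col)
open RProjectorJet (RG cornerV cornerJ rdotOf Jq Jq_apply Rdot biLoc_Jq)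
open RProjectorJetLeibniz (zero_comp comp_zero trK_zero spr_sub spr_comp spr_RG loc_cornerV loc_cornerJ loc_rdotOf abs_Csq_le_const loc_Sgh
  loc_Jq comp_Pgt_Pgt trK_Pgt comp_Jq_Pgt)

noncomputable section

/-! ## §1 The column family, the stripped adjoint averaging jet, and the two lattice identities -/

section Columns

variable (n : ℕ) (a : ℝ) (κ' : Fin 4) (u : Site 4)

/-- [our object] **THE COLUMN FAMILY `X = G′Q′*`** as a `Unit`-fibred kernel: fine site `p`, block label `y` ↦ `gq (n−1) a p y`
(the unweighted block sum of the ghost leg's row, `B5Hk103ScalarZd.gq`).  A definition; asserts nothing. -/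
def Xk : MKer 4 Unit := fun p y _ _ => gq (d := 4) (n - 1) a p y

/-- [our object] Unfolding. -/
theorem Xk_apply (p y : Site 4) (v w : Unit) : Xk n a p y v w = gq (d := 4) (n - 1) a p y := rfl

/-- [our object] **THE STRIPPED ADJOINT AVERAGING JET `(Q̇′ᴴ)_s`**: fine site `s`, block label `y` ↦ `−n⁴·qJet n κ′ u y s` (T6's `qAnti`
convention: `qAnti = Q′*·Q̇′ + Q̇′*·Q′` with `Q̇′ ↦ qJet`, `Q̇′* ↦ −n⁴·qJetᵀ`).  A definition; asserts nothing. -/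
def Qadj : MKer 4 Unit := fun s y _ _ => -((n : ℝ) ^ 4 * qJet n κ' u y s)

/-- [our object] Unfolding. -/
theorem Qadj_apply (s y : Site 4) (v w : Unit) : Qadj n κ' u s y v w = -((n : ℝ) ^ 4 * qJet n κ' u y s) := rfl

/-- [folklore] The column family is tame (rows decay in the block label, columns are summable, entries bounded). -/
theorem tame_Xk (ha : 0 < a) : Tame (Xk n a) := by
  have hδ := deltaU_pos 4 ha
  set C : ℝ := cU 4 a * Real.sqrt ((((n - 1 : ℕ) : ℝ) + 1) ^ 4) with hC
  have hC0 : 0 ≤ C := by rw [hC]; have := cU_pos 4 ha; positivity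
  refine ⟨fun p => ⟨fun y => C * Real.exp (-(deltaU 4 a * dist (blk (n - 1) p) y)), (summable_expX hδ _).mul_left C,
      fun y => by positivity, fun y v w => abs_gq_le (n - 1) ha p y⟩,
    fun y => ⟨fun p => |gq (d := 4) (n - 1) a p y|, (summable_gq_col (n - 1) ha y).abs, fun p => abs_nonneg _, fun p v w => le_rfl⟩,
    ⟨C, fun p y v w => abs_gq_le_const (n - 1) ha p y⟩⟩

/-- [folklore] The stripped adjoint averaging jet is localised at `(u, blk u)` (supported on `s ∈ B(blk u)`, `y = blk u`; `|·| ≤ 4n`). -/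
theorem loc_Qadj [NeZero n] : Loc (Qadj n κ' u) := by
  have hn : (0 : ℝ) < n := Nat.cast_pos.mpr (Nat.pos_of_ne_zero (NeZero.ne n))
  refine ⟨u, blk (n - 1) u, 4 * (n : ℝ) * Real.exp (4 * n), 1, one_pos, fun s y v w => ?_⟩
  rw [Qadj_apply, abs_neg]
  by_cases h : blk (n - 1) s = y ∧ blk (n - 1) u = y
  · have hsu : l1 (s - u) ≤ 4 * n := l1_sub_le_of_blk_eq n (h.1.trans h.2.symm)
    have hy : l1 (y - blk (n - 1) u) = 0 := by rw [← h.2, sub_self]; simp [l1]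
    have h1 := abs_qJet_le κ' u n y s
    rw [abs_mul, abs_of_pos (pow_pos hn 4), hy, add_zero]
    calc (n : ℝ) ^ 4 * |qJet n κ' u y s| ≤ (n : ℝ) ^ 4 * (4 / (n : ℝ) ^ 3) := mul_le_mul_of_nonneg_left h1 (by positivity)
      _ = 4 * n * (Real.exp (4 * n) * Real.exp (-(4 * n))) := by rw [← Real.exp_add, add_neg_cancel, Real.exp_zero]; field_simp
      _ ≤ 4 * n * (Real.exp (4 * n) * Real.exp (-1 * l1 (s - u))) := by
          refine mul_le_mul_of_nonneg_left (mul_le_mul_of_nonneg_left (Real.exp_le_exp.mpr (by linarith)) (Real.exp_pos _).le) (by positivity)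
      _ = 4 * (n : ℝ) * Real.exp (4 * n) * Real.exp (-1 * l1 (s - u)) := by ring
  · rw [qJet_eq_zero κ' u n h, mul_zero, abs_zero]; positivity

/-- [folklore] **`P ∘ X = X` ON THE LATTICE** (`RProjectorRange.tsum_gq_mul_Pgt` + `Pgt_symm`). -/
theorem comp_Pgt_Xk (ha : 0 < a) : comp (Pgt n a) (Xk n a) = Xk n a := by
  funext p y v w
  simp only [comp, Finset.univ_unique, PUnit.default_eq_unit, Finset.sum_singleton, Xk_apply]
  have e : (fun z : Site 4 => Pgt n a p z v () * gq (d := 4) (n - 1) a z y) = fun z => gq (d := 4) (n - 1) a z y * Pgt n a z p () v :=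
    funext fun z => by rw [Pgt_symm n ha p z v (), mul_comm]
  rw [e, tsum_gq_mul_Pgt n ha y p v]

end Columns

section Lattice

variable {d : ℕ}

/-- [folklore] `r ↦ (G′Q′*C)(r,y)·(G′Q′*)(r,y′)` is summable over the fine lattice (block majorant). -/
theorem summable_kerP_mul_gq (m : ℕ) {a : ℝ} (ha : 0 < a) (y y' : X d) :
    Summable fun r : X d => kerP m a r y * gq m a r y' := by
  refine summable_of_blk_majorant m (deltaP_pos d ha) y (C := cP d m a * (cU d a * Real.sqrt (((m : ℝ) + 1) ^ d))) fun r => ?_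
  rw [abs_mul]
  have h1 := abs_kerP_le m ha r y
  have h2 := abs_gq_le_const m ha r y'
  have h0 := cP_nonneg d m ha
  calc |kerP m a r y| * |gq m a r y'|
      ≤ (cP d m a * Real.exp (-(deltaP d a * dist (blk m r) y))) * (cU d a * Real.sqrt (((m : ℝ) + 1) ^ d)) :=
        mul_le_mul h1 h2 (abs_nonneg _) (by positivity)
    _ = cP d m a * (cU d a * Real.sqrt (((m : ℝ) + 1) ^ d)) * Real.exp (-(deltaP d a * dist y (blk m r))) := by rw [dist_comm]; ring

/-- [folklore] `p ↦ (G′Q′*)(p,y′)·(G′Q′*)(p,y″)` is summable (`B6QGGQ278Zd.summable_gq_mul_gq`). -/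
theorem summable_gq_mul_gq' (m : ℕ) {a : ℝ} (ha : 0 < a) (y' y'' : X d) :
    Summable fun p : X d => gq m a p y' * gq m a p y'' := B6QGGQ278Zd.summable_gq_mul_gq m ha y' y''

/-- [folklore] **`X⁺ ∘ X = 1` ON THE LATTICE** (in `RProjector`'s normalisation): `Σ'_r (G′Q′*C)(r,y)·(G′Q′*)(r,y′) = (m+1)^d·[y = y′]`.
Block by block, `sum_mul_kerP`, one Fubini (`tsum_mul_tsum_comm` under `abs_blockSum_le × c_C`), `tsum_bb_eq_kerSq`, `tsum_kerSq_mul_Csq`. -/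
theorem tsum_kerP_mul_gq (m : ℕ) {a : ℝ} (ha : 0 < a) (y y' : X d) :
    ∑' r : X d, kerP m a r y * gq m a r y' = ((m : ℝ) + 1) ^ d * (if y = y' then 1 else 0) := by
  classical
  have hδu := deltaU_pos d ha
  rw [← tsum_blocks m (summable_kerP_mul_gq m ha y y')]
  have hblock : ∀ w : X d, ∑ p ∈ B m w, kerP m a p y * gq m a p y' =
      ∑' y'' : X d, (∑ p ∈ B m w, gq m a p y' * gq m a p y'') * Csq m a y'' y := by
    intro w
    rw [← sum_mul_kerP m ha (B m w) (fun p => gq m a p y') y]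
    exact Finset.sum_congr rfl fun p _ => mul_comm _ _
  simp_rw [hblock]
  set K : ℝ := cU d a ^ 2 * ((m : ℝ) + 1) ^ d * cC d a with hK
  have hmaj : ∀ w y'' : X d, |(1 : ℝ) * ((∑ p ∈ B m w, gq m a p y' * gq m a p y'') * Csq m a y'' y)|
      ≤ K * Real.exp (-(deltaU d a * dist y' w)) * Real.exp (-(deltaU d a * dist w y'')) := by
    intro w y''
    rw [one_mul, abs_mul]
    have h1 := abs_blockSum_le m ha w y' y''
    have h2 := abs_Csq_le_const m ha y'' y
    have hc := cC_pos d ha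
    calc |∑ p ∈ B m w, gq m a p y' * gq m a p y''| * |Csq m a y'' y|
        ≤ (cU d a ^ 2 * ((m : ℝ) + 1) ^ d * (Real.exp (-(deltaU d a * dist w y')) * Real.exp (-(deltaU d a * dist w y'')))) * cC d a :=
          mul_le_mul h1 h2 (abs_nonneg _) (by positivity)
      _ = _ := by rw [hK, dist_comm w y']; ring
  have hswap := tsum_mul_tsum_comm (f := fun _ : X d => (1 : ℝ))
    (g := fun w y'' => (∑ p ∈ B m w, gq m a p y' * gq m a p y'') * Csq m a y'' y) hδu hδu y' hmaj
  simp only [one_mul] at hswap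
  rw [hswap]
  have hinner : ∀ y'' : X d, ∑' w : X d, (∑ p ∈ B m w, gq m a p y' * gq m a p y'') * Csq m a y'' y =
      ((m : ℝ) + 1) ^ d * (kerSq m a y' y'' * Csq m a y'' y) := by
    intro y''
    rw [tsum_mul_right, tsum_bb_eq_kerSq m ha y' y'', mul_assoc]
  simp_rw [hinner]
  rw [tsum_mul_left, tsum_kerSq_mul_Csq m ha y' y]
  by_cases h : y = y'
  · subst h; simp
  · rw [if_neg h, if_neg (Ne.symm h)]

end Lattice

section JX

variable (n : ℕ) [NeZero n] (a : ℝ) (κ' : Fin 4) (u : Site 4)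

/-- [folklore] **`J ∘ X = (Q̇′ᴴ)_s` ON THE LATTICE**: `comp (Jq n a κ′ u) (Xk n a) = Qadj n κ′ u` — the collapsed coarse piece of part 1
against the columns re-assembles the stripped adjoint averaging jet (`tsum_kerP_mul_gq`; the guard `[blk s = y]` of `qJet`). -/
theorem comp_Jq_Xk (ha : 0 < a) : comp (Jq n a κ' u) (Xk n a) = Qadj n κ' u := by
  funext s y v w
  simp only [comp, Finset.univ_unique, PUnit.default_eq_unit, Finset.sum_singleton, Jq_apply, Xk_apply, Qadj_apply]
  have e : (fun q : Site 4 => -(qJet n κ' u (blk (n - 1) s) s * kerP (d := 4) (n - 1) a q (blk (n - 1) s)) * gq (d := 4) (n - 1) a q y)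
      = fun q => -qJet n κ' u (blk (n - 1) s) s * (kerP (d := 4) (n - 1) a q (blk (n - 1) s) * gq (d := 4) (n - 1) a q y) :=
    funext fun q => by ring
  rw [e, tsum_mul_left, tsum_kerP_mul_gq (n - 1) ha (blk (n - 1) s) y, cast_pred_add_one n]
  by_cases h : blk (n - 1) s = y
  · rw [if_pos h, h]; ring
  · rw [if_neg h, qJet_eq_zero κ' u n (fun hh => h hh.1)]; ring

end JX

/-! ## §2 The generic second recognition identity -/

section Generic

variable {G P V J X Q : MKer 4 Unit}

/-- [folklore] **`(G − G∘P) ∘ X = 0`** from `P∘X = X` (`= (R∘G′)ᵀ∘X` for symmetric `G`, `P`). -/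
theorem comp_G_sub_GP_X (hG : Spr G) (hP : Spr P) (hX : Tame X) (hPX : comp P X = X) : comp (G - comp G P) X = 0 := by
  rw [comp_sub_left_tame hG.tame (spr_comp hG hP).tame hX, ← comp_assoc_tame hG.tame hP.tame hX, hPX, sub_self]

/-- [folklore] `(R∘G′)ᵀ = G − G∘P` for `Gᵀ = G`, `Pᵀ = P`. -/
theorem trK_RG (hGsym : trK G = G) (hPsym : trK P = P) : trK (RG G P) = G - comp G P := by
  rw [RG, trK_sub, trK_comp, hGsym, hPsym]

/-- [folklore] `cornerV ∘ X = (R∘G′)∘V∘X` from `P∘X = X`. -/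
theorem cornerV_comp_X (hG : Spr G) (hP : Spr P) (hV : Loc V) (hX : Tame X) (hPX : comp P X = X) :
    comp (cornerV G P V) X = comp (comp (RG G P) V) X := by
  rw [cornerV, ← comp_assoc_tame ((spr_RG hG hP).comp_loc hV).tame hP.tame hX, hPX]

/-- [folklore] `cornerVᵀ ∘ X = 0` (`Gᵀ = G`, `Pᵀ = P`, `Vᵀ = −V`, `P∘X = X`). -/
theorem trK_cornerV_comp_X (hG : Spr G) (hP : Spr P) (hV : Loc V) (hX : Tame X) (hGsym : trK G = G) (hPsym : trK P = P)
    (hVanti : trK V = -V) (hPX : comp P X = X) : comp (trK (cornerV G P V)) X = 0 := by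
  have hGP : Spr (G - comp G P) := spr_sub hG (spr_comp hG hP)
  rw [cornerV, trK_comp, trK_comp, trK_RG hGsym hPsym, hPsym, hVanti, comp_neg_left, comp_neg_right, comp_neg_left,
    ← comp_assoc_tame hP.tame (hV.comp_spr hGP).tame hX, ← comp_assoc_tame hV.tame hGP.tame hX, comp_G_sub_GP_X hG hP hX hPX, comp_zero,
    comp_zero, neg_zero]

/-- [folklore] `cornerJ ∘ X = (R∘G′)∘Q` from `J∘X = Q`. -/
theorem cornerJ_comp_X (hG : Spr G) (hP : Spr P) (hJ : Loc J) (hX : Tame X) (hJX : comp J X = Q) :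
    comp (cornerJ G P J) X = comp (RG G P) Q := by
  rw [cornerJ, ← comp_assoc_tame (spr_RG hG hP).tame hJ.tame hX, hJX]

/-- [folklore] `cornerJᵀ ∘ X = 0`. -/
theorem trK_cornerJ_comp_X (hG : Spr G) (hP : Spr P) (hJ : Loc J) (hX : Tame X) (hGsym : trK G = G) (hPsym : trK P = P)
    (hPX : comp P X = X) : comp (trK (cornerJ G P J)) X = 0 := by
  have hGP : Spr (G - comp G P) := spr_sub hG (spr_comp hG hP)
  rw [cornerJ, trK_comp, trK_RG hGsym hPsym, ← comp_assoc_tame hJ.trK.tame hGP.tame hX, comp_G_sub_GP_X hG hP hX hPX, comp_zero]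

/-- [folklore] `R∘(G′∘K) = (R∘G′)∘K` with `R = idK − P`, for tame `K`. -/
theorem comp_R_comp_G (hG : Spr G) (hP : Spr P) {K : MKer 4 Unit} (hK : Tame K) :
    comp (idK - P) (comp G K) = comp (RG G P) K := by
  have tI : Tame (idK : MKer 4 Unit) := spr_idK.tame
  have tR : Tame (idK - P : MKer 4 Unit) := (spr_sub spr_idK hP).tame
  rw [comp_assoc_tame tR hG.tame hK, comp_sub_left_tame tI hP.tame hG.tame, comp_idK_left, RG]

/-- [folklore] `R∘((G′∘V)∘X) = ((R∘G′)∘V)∘X` with `R = idK − P`. -/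
theorem comp_R_comp_GV_X (hG : Spr G) (hP : Spr P) (hV : Loc V) (hX : Tame X) :
    comp (idK - P) (comp (comp G V) X) = comp (comp (RG G P) V) X := by
  have tI : Tame (idK : MKer 4 Unit) := spr_idK.tame
  have tR : Tame (idK - P : MKer 4 Unit) := (spr_sub spr_idK hP).tame
  rw [comp_assoc_tame tR (hG.comp_loc hV).tame hX, comp_assoc_tame tR hG.tame hV.tame, comp_sub_left_tame tI hP.tame hG.tame,
    comp_idK_left, RG]

/-- [folklore] **THE GENERIC SECOND RECOGNITION IDENTITY** `Ṙ∘X + R∘Ẋ = 0`, with `R∘Ẋ` written as `R∘(G∘Q) − R∘((G∘V)∘X)`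
(`Ẋ = −G∘V∘X + G∘Q`): hypotheses `Spr G`, `Spr P`, `Loc V`, `Loc J`, `Tame X`, `Tame Q`, `Gᵀ = G`, `Pᵀ = P`, `Vᵀ = −V`, `P∘X = X`,
`J∘X = Q`. -/
theorem leibniz_X (hG : Spr G) (hP : Spr P) (hV : Loc V) (hJ : Loc J) (hX : Tame X) (hQ : Tame Q) (hGsym : trK G = G)
    (hPsym : trK P = P) (hVanti : trK V = -V) (hPX : comp P X = X) (hJX : comp J X = Q) :
    comp (rdotOf G P V J) X + (comp (idK - P) (comp G Q) - comp (idK - P) (comp (comp G V) X)) = 0 := by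
  have hCV := loc_cornerV hG hP hV
  have hCJ := loc_cornerJ hG hP hJ
  have tV : Tame (cornerV G P V - trK (cornerV G P V)) := (hCV.sub hCV.trK).tame
  have tJ : Tame (cornerJ G P J - trK (cornerJ G P J)) := (hCJ.sub hCJ.trK).tame
  rw [rdotOf, comp_sub_left_tame tV tJ hX, comp_sub_left_tame hCV.tame hCV.trK.tame hX, comp_sub_left_tame hCJ.tame hCJ.trK.tame hX,
    cornerV_comp_X hG hP hV hX hPX, trK_cornerV_comp_X hG hP hV hX hGsym hPsym hVanti hPX, cornerJ_comp_X hG hP hJ hX hJX,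
    trK_cornerJ_comp_X hG hP hJ hX hGsym hPsym hPX, comp_R_comp_G hG hP hQ, comp_R_comp_GV_X hG hP hV hX]
  abel

end Generic

/-! ## §3 The instance -/

section Instance

variable (n : ℕ) [NeZero n] (a cK cQ : ℝ) (κ' : Fin 4) (u : Site 4)

omit [NeZero n] in
/-- [folklore] `Vᵀ = −V` for the ghost stencil (`GhostStencil.Sgh_antisymm`). -/
theorem trK_Sgh : trK (Sgh n cK cQ κ' u) = -Sgh n cK cQ κ' u := by
  funext x z v w
  rw [trK_apply]
  exact Sgh_antisymm κ' u n cK cQ x z v w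

/-- [folklore] **THE SECOND RECOGNITION IDENTITY FOR THE TYPED JET**: with `Ṙ := Rdot n a cK cQ κ′ u`, `R := idK − Pgt n a`,
`X := Xk n a`, `G := Ggh n a`, `V := Sgh n cK cQ κ′ u`, `Q := Qadj n κ′ u` (so `Ẋ_s = −G∘V∘X + G∘Q`):
`Ṙ∘X + (R∘(G∘Q) − R∘((G∘V)∘X)) = 0` — GIVEN the fine `ℓ¹` decay of the projector (binder `hP`, bookkeeping only).  With part 2's
`leibniz_R_Rdot` this is the full socket `ProjectorJetStripped.eq_cojetSkew_iff`, on the lattice. -/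
theorem leibniz_X_Rdot (ha : 0 < a) {CP δP : ℝ} (hδP : 0 < δP) (hP : Decays (Pgt n a) CP δP) :
    comp (Rdot n a cK cQ κ' u) (Xk n a) +
      (comp (idK - Pgt n a) (comp (Ggh n a) (Qadj n κ' u)) -
        comp (idK - Pgt n a) (comp (comp (Ggh n a) (Sgh n cK cQ κ' u)) (Xk n a))) = 0 :=
  leibniz_X (spr_Ggh n a ha) ⟨CP, δP, hδP, hP⟩ (loc_Sgh n κ' u cK cQ) (loc_Jq n a κ' u ha) (tame_Xk n a ha) (loc_Qadj n κ' u).tame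
    (GhostLeg.trK_Ggh n a ha) (trK_Pgt n a ha) (trK_Sgh n cK cQ κ' u) (comp_Pgt_Xk n a ha) (comp_Jq_Xk n a κ' u ha)

end Instance

end

end Summit.QuantumFields.BalabanUV.Beta.D1BFx.RProjectorJetColumns
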